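import Mathlib
import HarnessLib
import Summits.KontsevichZagierPeriods.Zeta5Search.VWPStepAlgebra
import Summits.KontsevichZagierPeriods.Zeta5Search.VWPContinuationH0
import Summits.KontsevichZagierPeriods.Zeta5Search.VWPBaseCase
import Summits.KontsevichZagierPeriods.Zeta5Search.SorokinIntegrableVWP
import Summits.KontsevichZagierPeriods.Zeta5Search.VWPSeriesSummable

/-!
# ζ(5) search — Zudilin's identity (4) at complex parameters, by induction on `k` (cell `pub-zeta5`, ct-1 g28)

HONEST FRAMING: systematic search; no irrationality claim unless kernel-certified.  An identity between a very-well-poised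
hypergeometric series and a Sorokin-type multiple integral; nothing here is an irrationality result, a worthiness exponent or a
denominator statement; no named fact is discharged in this file; no definition is introduced.

Brick B6e-3b of `HOME/ct-1/g28/VWP-BLUEPRINT-g28.md` §3/§5 — the induction assembly of the corrected route.  Writing `S(n)(h)` for the
typed-shape identity
`(∏_{i∈Icc 1 (n+1)}Γ(1+h₀−h_i−h_{i+1}))/(Γ(h₁)Γ(h_{n+2})) · Σ_μ (h₀+2μ)∏_{i<n+3}Γ(h_i+μ)/Γ(1+h₀−h_i+μ)(−1)^{(n+3)μ}
   = ∫_{[0,1]^n} ∏_j x_j^{h_{j+2}−1}(1−x_j)^{(1+h₀−h_{j+3})−h_{j+2}−1} Q_n^{−h₁}`,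
we prove `S(n)(h)` for every `n ≥ 1` and every COMPLEX `h` whose real parts satisfy Zudilin's (5), (6) and positivity
(`Re h₀, Re h₁, Re h_{n+2} > 0`, `Re h₁ + Re h₂ < 1 + Re h₀`):

* base `n = 1`: `VWPBaseCase.S_one` (Dougall + Beta);
* step `n → n+1`: for REAL `h₀ = t` larger than an explicit bound `L'(h)` every side condition of `VWPStepAlgebra.step` (sub-region (J) with
  `θ = 0`, (C), integrability of both integrands, absolute convergence of the reduced series — `summable_norm_gap`) holds, and the inductive
  hypothesis is `S(n)` at the complex parameters `(t; t₀−iy, h₃, …)`; then `VWPContinuationH0.continuation` (identity theorem in `h₀` on the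
  half-plane `Re h₀ > M(h)`) removes the largeness of `h₀`.

Main result: **`identity`**.  Theorems only; imports `VWPStepAlgebra`, `VWPContinuationH0`, `VWPBaseCase`, `SorokinIntegrableVWP`,
`VWPSeriesSummable`.
-/

noncomputable section

namespace Summit.KontsevichZagierPeriods.Zeta5Search.VWPInduction

open MeasureTheory Set
open Literature.NumberTheory.Irrationality.Zudilin2002 (nestedQ sorokinIntegrand)
open Summit.KontsevichZagierPeriods.Zeta5Search.VWPStepAlgebra (step)
open Summit.KontsevichZagierPeriods.Zeta5Search.VWPContinuationH0 (continuation)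
open Summit.KontsevichZagierPeriods.Zeta5Search.VWPBaseCase (S_one)
open Summit.KontsevichZagierPeriods.Zeta5Search.SorokinIntegrableVWP (integrableOn_integrand_vwp)
open Summit.KontsevichZagierPeriods.Zeta5Search.SorokinConvergence (integrableOn_sorokinIntegrand)
open Summit.KontsevichZagierPeriods.Zeta5Search.VWPSeriesSummable (norm_prod_Gamma_ratio_le)

/-! ### 1. Absolute convergence of the reduced series (the `hD` input of `step`, weight exponent `θ = 0`) -/

/-- **Summability of the reduced series**: for `Re g₀ > 0`, `Re g_i > 0` and `Re(1+g₀−g_i) > 0` (`i ∈ Icc 3 (n+3)`) and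
`Re g₀ + 2Σ_{i=3}^{n+3} Re g_i − (n+1)(1 + Re g₀) < −1`, the norms of
`(g₀+2μ)·(Γ(g₀+μ)/Γ(1+g₀−g₀+μ))·∏_{i=3}^{n+3}Γ(g_i+μ)/Γ(1+g₀−g_i+μ)·(−1)^{(n+3)μ}` are summable (polynomial comparison, as in
`VWPSeriesSummable.summable_vwpTerm`). -/
theorem summable_norm_gap (n : ℕ) (g : ℕ → ℂ) (h0 : 0 < (g 0).re) (hpos : ∀ i ∈ Finset.Icc 3 (n + 3), 0 < (g i).re)
    (hden : ∀ i ∈ Finset.Icc 3 (n + 3), 0 < (1 + g 0 - g i).re)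
    (hE : (g 0).re + 2 * (∑ i ∈ Finset.Icc 3 (n + 3), (g i).re) - ((n : ℝ) + 1) * (1 + (g 0).re) < -1) :
    Summable fun μ : ℕ => ‖(g 0 + 2 * (μ : ℂ)) * (Complex.Gamma (g 0 + μ) / Complex.Gamma (1 + g 0 - g 0 + μ) *
        ∏ i ∈ Finset.Icc 3 (n + 3), Complex.Gamma (g i + μ) / Complex.Gamma (1 + g 0 - g i + μ)) * (-1 : ℂ) ^ ((n + 3) * μ)‖ := by
  set S : Finset ℕ := insert 0 (Finset.Icc 3 (n + 3)) with hSdef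
  have h0S : (0 : ℕ) ∉ Finset.Icc 3 (n + 3) := by simp
  have hζ : ∀ j ∈ S, 0 < (g j).re := by
    intro j hj
    rcases Finset.mem_insert.1 hj with rfl | hj
    · exact h0
    · exact hpos j hj
  have hξ : ∀ j ∈ S, 0 < ((fun j => 1 + g 0 - g j) j).re := by
    intro j hj
    rcases Finset.mem_insert.1 hj with rfl | hj
    · simp
    · exact hden j hj
  obtain ⟨C, hC, hprod⟩ := norm_prod_Gamma_ratio_le S g (fun j => 1 + g 0 - g j) hζ hξ
  set E : ℝ := 1 + (∑ j ∈ S, ((g j).re - (1 + g 0 - g j).re)) with hEdef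
  have hcard : ((Finset.Icc 3 (n + 3)).card : ℝ) = n + 1 := by
    rw [Nat.card_Icc, show n + 3 + 1 - 3 = n + 1 by omega]; push_cast; ring
  have hE1 : E < -1 := by
    have : E = (g 0).re + 2 * (∑ i ∈ Finset.Icc 3 (n + 3), (g i).re) - ((n : ℝ) + 1) * (1 + (g 0).re) := by
      rw [hEdef, hSdef, Finset.sum_insert h0S]
      simp only [Complex.add_re, Complex.sub_re, Complex.one_re, Finset.sum_sub_distrib, Finset.sum_const, nsmul_eq_mul, hcard]
      ring
    rw [this]; exact hE
  have hg : Summable fun μ : ℕ => (‖g 0‖ + 2) * C * (μ : ℝ) ^ E := (Real.summable_nat_rpow.2 hE1).mul_left _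
  refine Summable.of_norm_bounded_eventually_nat hg ?_
  rw [Filter.eventually_atTop]
  refine ⟨⌈1 + ∑ j ∈ S, (g j).re⌉₊, fun μ hμ => ?_⟩
  have hμR : 1 + ∑ j ∈ S, (g j).re ≤ (μ : ℝ) := le_trans (Nat.le_ceil _) (by exact_mod_cast hμ)
  have hsum0 : 0 ≤ ∑ j ∈ S, (g j).re := Finset.sum_nonneg fun j hj => (hζ j hj).le
  have hμ1 : 1 ≤ (μ : ℝ) := by linarith
  have hμ0 : 0 < (μ : ℝ) := by linarith
  have hμj : ∀ j ∈ S, (g j).re ≤ (μ : ℝ) := fun j hj => by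
    have := Finset.single_le_sum (f := fun j => (g j).re) (fun i hi => (hζ i hi).le) hj
    linarith
  have hP := hprod μ hμ1 hμj
  rw [hSdef, Finset.prod_insert h0S] at hP
  have hlin : ‖g 0 + 2 * (μ : ℂ)‖ ≤ (‖g 0‖ + 2) * (μ : ℝ) ^ (1 : ℝ) := by
    rw [Real.rpow_one]
    calc ‖g 0 + 2 * (μ : ℂ)‖ ≤ ‖g 0‖ + ‖(2 : ℂ) * (μ : ℂ)‖ := norm_add_le _ _
      _ = ‖g 0‖ + 2 * μ := by rw [norm_mul, Complex.norm_two, Complex.norm_natCast]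
      _ ≤ (‖g 0‖ + 2) * μ := by nlinarith [norm_nonneg (g 0)]
  rw [norm_norm, norm_mul, norm_mul, norm_pow, norm_neg, norm_one, one_pow, mul_one, norm_mul, norm_prod]
  calc ‖g 0 + 2 * (μ : ℂ)‖ * (‖Complex.Gamma (g 0 + μ) / Complex.Gamma (1 + g 0 - g 0 + μ)‖ *
        ∏ i ∈ Finset.Icc 3 (n + 3), ‖Complex.Gamma (g i + μ) / Complex.Gamma (1 + g 0 - g i + μ)‖)
      ≤ ((‖g 0‖ + 2) * (μ : ℝ) ^ (1 : ℝ)) * (C * (μ : ℝ) ^ (∑ j ∈ S, ((g j).re - (1 + g 0 - g j).re))) :=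
        mul_le_mul hlin hP (mul_nonneg (norm_nonneg _) (Finset.prod_nonneg fun _ _ => norm_nonneg _)) (by positivity)
    _ = (‖g 0‖ + 2) * C * (μ : ℝ) ^ E := by rw [hEdef, Real.rpow_add hμ0]; ring

/-! ### 2. The identity for all `n ≥ 1` -/

/-- **Zudilin's identity (4) at complex parameters** [Zudilin math/0206177, Theorem, eq. (4) with (5)–(6); proved along the corrected
route of `VWP-BLUEPRINT-g28.md` §3]: for `n ≥ 1` and `h : ℕ → ℂ` with `(2/(n+1))Σ_{j=1}^{n+2}Re h_j < 1 + Re h₀`,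
`0 < Re h_j < 1 + Re h₀ − Re h_{j+1}` (`2 ≤ j ≤ n+1`), `Re h₀, Re h₁, Re h_{n+2} > 0`, `Re h₁ + Re h₂ < 1 + Re h₀`, the identity `S(n)(h)` holds. -/
theorem identity {n : ℕ} (hn : 1 ≤ n) (h : ℕ → ℂ)
    (h5 : (2 / ((n : ℝ) + 1)) * (∑ j ∈ Finset.Icc 1 (n + 2), (h j).re) < 1 + (h 0).re)
    (h6 : ∀ j ∈ Finset.Icc 2 (n + 1), 0 < (h j).re ∧ (h j).re < 1 + (h 0).re - (h (j + 1)).re)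
    (h0 : 0 < (h 0).re) (h1 : 0 < (h 1).re) (hn2 : 0 < (h (n + 2)).re) (h12 : (h 1).re + (h 2).re < 1 + (h 0).re) :
    (∏ i ∈ Finset.Icc 1 (n + 1), Complex.Gamma (1 + h 0 - h i - h (i + 1))) / (Complex.Gamma (h 1) * Complex.Gamma (h (n + 2))) *
        (∑' μ : ℕ, (h 0 + 2 * (μ : ℂ)) * (∏ i ∈ Finset.range (n + 3), Complex.Gamma (h i + μ) / Complex.Gamma (1 + h 0 - h i + μ)) *
          (-1 : ℂ) ^ ((n + 3) * μ)) =
      ∫ x in Set.pi univ (fun _ : Fin n => Icc (0 : ℝ) 1),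
        (∏ j : Fin n, ((x j : ℝ) : ℂ) ^ (h (j + 2) - 1) * (1 - ((x j : ℝ) : ℂ)) ^ ((1 + h 0 - h (j + 3)) - h (j + 2) - 1)) *
          ((nestedQ (List.ofFn x) : ℝ) : ℂ) ^ (-h 1) := by
  induction n, hn using Nat.le_induction generalizing h with
  | base =>
    have hI : Finset.Icc 1 (1 + 2) = {1, 2, 3} := by decide
    rw [hI, Finset.sum_insert (by decide), Finset.sum_insert (by decide), Finset.sum_singleton] at h5
    norm_num at h5
    exact S_one h h0 h1 (h6 2 (by simp)).1 (by simpa using hn2) (by linarith)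
  | succ n hn IH =>
    -- positivity of all `Re h_i`, `1 ≤ i ≤ n+3`, and the crude bound `B`
    have hpos : ∀ i ∈ Finset.Icc 1 (n + 1 + 2), 0 < (h i).re := by
      intro i hi
      rw [Finset.mem_Icc] at hi
      rcases Nat.lt_or_ge i 2 with hi1 | hi2
      · obtain rfl : i = 1 := by omega
        exact h1
      rcases Nat.lt_or_ge i (n + 1 + 2) with hi3 | hi4
      · exact (h6 i (Finset.mem_Icc.2 ⟨hi2, by omega⟩)).1
      · obtain rfl : i = n + 1 + 2 := by omega
        exact hn2
    set B : ℝ := ∑ j ∈ Finset.Icc 1 (n + 1 + 2), (h j).re with hB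
    have hB0 : 0 ≤ B := Finset.sum_nonneg fun j hj => (hpos j hj).le
    have hle1 : ∀ i ∈ Finset.Icc 1 (n + 1 + 2), (h i).re ≤ B := fun i hi =>
      Finset.single_le_sum (f := fun j => (h j).re) (fun j hj => (hpos j hj).le) hi
    have hle2 : ∀ i i' : ℕ, 1 ≤ i → i' ≤ n + 1 + 2 → i < i' → (h i).re + (h i').re ≤ B := by
      intro i i' hi hi' hlt
      have hsub : ({i, i'} : Finset ℕ) ⊆ Finset.Icc 1 (n + 1 + 2) := by
        intro j hj
        simp only [Finset.mem_insert, Finset.mem_singleton] at hj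
        rcases hj with rfl | rfl <;> exact Finset.mem_Icc.2 ⟨by omega, by omega⟩
      have := Finset.sum_le_sum_of_subset_of_nonneg hsub (f := fun j => (h j).re) (fun j hj _ => (hpos j hj).le)
      rw [Finset.sum_pair (by omega)] at this
      exact this
    have hle3 : (h 1).re + (h 2).re + (h 3).re ≤ B := by
      have hsub : ({1, 2, 3} : Finset ℕ) ⊆ Finset.Icc 1 (n + 1 + 2) := by
        intro j hj
        simp only [Finset.mem_insert, Finset.mem_singleton] at hj
        rcases hj with rfl | rfl | rfl <;> exact Finset.mem_Icc.2 ⟨by omega, by omega⟩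
      have := Finset.sum_le_sum_of_subset_of_nonneg hsub (f := fun j => (h j).re) (fun j hj _ => (hpos j hj).le)
      rw [Finset.sum_insert (by decide), Finset.sum_insert (by decide), Finset.sum_singleton] at this
      linarith
    have h2 : 0 < (h 2).re := (h6 2 (Finset.mem_Icc.2 ⟨le_rfl, by omega⟩)).1
    -- the small positive `t₀` and the typed lower bounds `M < Re h₀`
    set t₀ : ℝ := min (h 1).re (h 2).re / 2 with ht₀def
    have ht₀ : 0 < t₀ := by rw [ht₀def]; exact div_pos (lt_min h1 h2) two_pos
    have ht1 : t₀ < (h 1).re := by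
      rw [ht₀def]; have := min_le_left (h 1).re (h 2).re; linarith
    have ht2 : t₀ < (h 2).re := by
      rw [ht₀def]; have := min_le_right (h 1).re (h 2).re; linarith
    have hne6 : (Finset.Icc 2 (n + 1 + 1)).Nonempty := ⟨2, Finset.mem_Icc.2 ⟨le_rfl, by omega⟩⟩
    set m6 : ℝ := (Finset.Icc 2 (n + 1 + 1)).sup' hne6 (fun j => (h j).re + (h (j + 1)).re - 1) with hm6
    set M : ℝ := max (max (max 0 ((h 1).re + (h 2).re - 1)) m6)
      ((2 / (((n + 1 : ℕ) : ℝ) + 1)) * (∑ j ∈ Finset.Icc 1 (n + 1 + 2), (h j).re) - 1) with hMdef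
    have hM0 : 0 ≤ M := le_max_of_le_left (le_max_of_le_left (le_max_left _ _))
    have hM12 : (h 1).re + (h 2).re - 1 ≤ M := le_max_of_le_left (le_max_of_le_left (le_max_right _ _))
    have hM6 : ∀ j ∈ Finset.Icc 2 (n + 1 + 1), (h j).re + (h (j + 1)).re - 1 ≤ M := fun j hj =>
      le_max_of_le_left (le_max_of_le_right (Finset.le_sup' (fun j => (h j).re + (h (j + 1)).re - 1) hj))
    have hM5 : (2 / (((n + 1 : ℕ) : ℝ) + 1)) * (∑ j ∈ Finset.Icc 1 (n + 1 + 2), (h j).re) - 1 ≤ M := le_max_right _ _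
    have hv : M < (h 0).re := by
      refine max_lt (max_lt (max_lt h0 (by linarith)) ?_) (by linarith)
      rw [hm6, Finset.sup'_lt_iff]
      intro j hj
      linarith [(h6 j hj).2]
    -- the largeness threshold
    set L' : ℝ := max M (2 * B + t₀ + 2) with hL'
    have hML : M ≤ L' := le_max_left _ _
    have hn1 : (1 : ℝ) ≤ n := by exact_mod_cast hn
    -- the identity at every real `h₀ = t > L'`
    have hreal : ∀ t : ℝ, L' < t →
        (∏ i ∈ Finset.Icc 1 (n + 1 + 1), Complex.Gamma (1 + Function.update h 0 (t : ℂ) 0 - Function.update h 0 (t : ℂ) i -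
              Function.update h 0 (t : ℂ) (i + 1))) /
            (Complex.Gamma (Function.update h 0 (t : ℂ) 1) * Complex.Gamma (Function.update h 0 (t : ℂ) (n + 1 + 2))) *
          (∑' μ : ℕ, (Function.update h 0 (t : ℂ) 0 + 2 * (μ : ℂ)) *
            (∏ i ∈ Finset.range (n + 1 + 3), Complex.Gamma (Function.update h 0 (t : ℂ) i + μ) /
              Complex.Gamma (1 + Function.update h 0 (t : ℂ) 0 - Function.update h 0 (t : ℂ) i + μ)) * (-1 : ℂ) ^ ((n + 1 + 3) * μ)) =
        ∫ x in Set.pi univ (fun _ : Fin (n + 1) => Icc (0 : ℝ) 1),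
          (∏ j : Fin (n + 1), ((x j : ℝ) : ℂ) ^ (Function.update h 0 (t : ℂ) (j + 2) - 1) *
              (1 - ((x j : ℝ) : ℂ)) ^ ((1 + Function.update h 0 (t : ℂ) 0 - Function.update h 0 (t : ℂ) (j + 3)) -
                Function.update h 0 (t : ℂ) (j + 2) - 1)) *
            ((nestedQ (List.ofFn x) : ℝ) : ℂ) ^ (-Function.update h 0 (t : ℂ) 1) := by
      intro t ht
      have htM : M < t := lt_of_le_of_lt hML ht
      have htL : 2 * B + t₀ + 2 < t := lt_of_le_of_lt (le_max_right _ _) ht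
      have ht0 : 0 < t := lt_of_le_of_lt hM0 htM
      -- the parameters with `h₀` replaced by `t`
      have hg0 : Function.update h 0 (t : ℂ) 0 = t := Function.update_self _ _ _
      have hgi : ∀ i, i ≠ 0 → Function.update h 0 (t : ℂ) i = h i := fun i hi => Function.update_of_ne hi _ _
      have hg0re : (Function.update h 0 (t : ℂ) 0).re = t := by rw [hg0, Complex.ofReal_re]
      have hg0im : (Function.update h 0 (t : ℂ) 0).im = 0 := by rw [hg0, Complex.ofReal_im]
      have hg1 := hgi 1 one_ne_zero
      have hg2 := hgi 2 two_ne_zero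
      have hg3 := hgi 3 (by norm_num)
      -- pairs of parameters are bounded by `B < t`
      have hpair : ∀ m, m + 4 ≤ n + 1 + 2 →
          1 + t - B ≤ (1 + Function.update h 0 (t : ℂ) 0 - Function.update h 0 (t : ℂ) (m + 4)).re -
            (Function.update h 0 (t : ℂ) (m + 3)).re := by
        intro m hm
        rw [hgi (m + 4) (by omega), hgi (m + 3) (by omega), hg0]
        simp only [Complex.add_re, Complex.sub_re, Complex.one_re, Complex.ofReal_re]
        linarith [hle2 (m + 3) (m + 4) (by omega) hm (by omega)]
      refine step (ε := 1) (θ := 0) (t₀ := t₀) hn (Function.update h 0 (t : ℂ)) hg0im ht₀ (by rw [hg1]; exact ht1)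
        (by rw [hg2]; exact ht2) ?_ ?_ ?_ (Or.inl rfl) le_rfl ?_ ?_ ?_ ?_ ?_
      · -- (C)
        rw [hg1, hg2, hg3, hg0]
        simp only [Complex.add_re, Complex.sub_re, Complex.one_re, Complex.ofReal_re]
        linarith
      · rw [hg1, hg2, hg0re]; linarith
      · rw [hg0re]; linarith
      · -- (J) with `θ = 0`
        rw [hg1, hg2, hg0re]; linarith
      · -- integrability of the `(n+1)`-fold integrand
        refine integrableOn_integrand_vwp (k := n + 1) (by omega) (Function.update h 0 (t : ℂ)) ?_ ?_ (by rw [hg1]; exact h1.le)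
          (by rw [hg1, hg2, hg0re]; linarith)
        · have hs : ∑ j ∈ Finset.Icc 1 (n + 1 + 2), (Function.update h 0 (t : ℂ) j).re = B :=
            Finset.sum_congr rfl fun j hj => by rw [hgi j (by have := (Finset.mem_Icc.1 hj).1; omega)]
          rw [hs, hg0re]
          have hq : 2 / (((n + 1 : ℕ) : ℝ) + 1) ≤ 1 := by
            rw [div_le_one (by positivity)]; push_cast; linarith
          nlinarith
        · intro j hj
          have hj' := Finset.mem_Icc.1 hj
          rw [hgi j (by omega), hgi (j + 1) (by omega), hg0re]
          exact ⟨(h6 j hj).1, by linarith [hle2 j (j + 1) (by omega) (by omega) (by omega)]⟩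
      · -- integrability of the real `n`-fold integrand at `a₀ = t₀`
        refine integrableOn_sorokinIntegrand hn ht₀.le ?_ ?_ ?_
        · intro j hj
          rw [hgi (j + 1 + 2) (by omega), hgi (j + 1 + 3) (by omega), hg0]
          simp only [Complex.add_re, Complex.sub_re, Complex.one_re, Complex.ofReal_re]
          exact ⟨(h6 (j + 1 + 2) (Finset.mem_Icc.2 ⟨by omega, by omega⟩)).1,
            by linarith [hle2 (j + 1 + 2) (j + 1 + 3) (by omega) (by omega) (by omega)]⟩
        · intro i hi
          have hsum : 1 + t - B ≤ ∑ m ∈ Finset.range (i + 1),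
              ((1 + Function.update h 0 (t : ℂ) 0 - Function.update h 0 (t : ℂ) (2 * m + 1 + 3)).re -
                (Function.update h 0 (t : ℂ) (2 * m + 1 + 2)).re) := by
            calc 1 + t - B ≤ (1 + Function.update h 0 (t : ℂ) 0 - Function.update h 0 (t : ℂ) (2 * 0 + 1 + 3)).re -
                  (Function.update h 0 (t : ℂ) (2 * 0 + 1 + 2)).re := hpair 0 (by omega)
              _ ≤ _ := Finset.single_le_sum (f := fun m => (1 + Function.update h 0 (t : ℂ) 0 -
                    Function.update h 0 (t : ℂ) (2 * m + 1 + 3)).re - (Function.update h 0 (t : ℂ) (2 * m + 1 + 2)).re)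
                  (fun m hm => by
                    have hm' := Finset.mem_range.1 hm
                    have := hpair (2 * m) (by omega)
                    rw [show 2 * m + 1 + 3 = 2 * m + 4 by ring, show 2 * m + 1 + 2 = 2 * m + 3 by ring]
                    linarith) (Finset.mem_range.2 (Nat.succ_pos i))
          have hlast : 0 < (Function.update h 0 (t : ℂ) (2 * i + 1 + 1 + 2)).re := by
            rw [hgi (2 * i + 1 + 1 + 2) (by omega)]
            exact (h6 (2 * i + 1 + 1 + 2) (Finset.mem_Icc.2 ⟨by omega, by omega⟩)).1
          linarith
        · intro hodd
          obtain ⟨r, hr⟩ := hodd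
          have hsum : 1 + t - B ≤ ∑ m ∈ Finset.range ((n + 1) / 2),
              ((1 + Function.update h 0 (t : ℂ) 0 - Function.update h 0 (t : ℂ) (2 * m + 1 + 3)).re -
                (Function.update h 0 (t : ℂ) (2 * m + 1 + 2)).re) := by
            calc 1 + t - B ≤ (1 + Function.update h 0 (t : ℂ) 0 - Function.update h 0 (t : ℂ) (2 * 0 + 1 + 3)).re -
                  (Function.update h 0 (t : ℂ) (2 * 0 + 1 + 2)).re := hpair 0 (by omega)
              _ ≤ _ := Finset.single_le_sum (f := fun m => (1 + Function.update h 0 (t : ℂ) 0 -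
                    Function.update h 0 (t : ℂ) (2 * m + 1 + 3)).re - (Function.update h 0 (t : ℂ) (2 * m + 1 + 2)).re)
                  (fun m hm => by
                    have hm' := Finset.mem_range.1 hm
                    have := hpair (2 * m) (by omega)
                    rw [show 2 * m + 1 + 3 = 2 * m + 4 by ring, show 2 * m + 1 + 2 = 2 * m + 3 by ring]
                    linarith) (Finset.mem_range.2 (by omega))
          linarith
      · -- absolute convergence of the reduced series (`θ = 0`: the weight is `1`)
        have hS := summable_norm_gap n (Function.update h 0 (t : ℂ)) (by rw [hg0re]; exact ht0)
          (fun i hi => by rw [hgi i (by have := (Finset.mem_Icc.1 hi).1; omega)]; exact hpos i (Finset.mem_Icc.2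
            ⟨by have := (Finset.mem_Icc.1 hi).1; omega, (Finset.mem_Icc.1 hi).2⟩))
          (fun i hi => by
            have hi' := Finset.mem_Icc.1 hi
            rw [hgi i (by omega), hg0]
            simp only [Complex.add_re, Complex.sub_re, Complex.one_re, Complex.ofReal_re]
            linarith [hle1 i (Finset.mem_Icc.2 ⟨by omega, hi'.2⟩)])
          (by
            have hs3 : ∑ i ∈ Finset.Icc 3 (n + 3), (Function.update h 0 (t : ℂ) i).re ≤ B := by
              rw [Finset.sum_congr rfl fun i hi => by rw [hgi i (by have := (Finset.mem_Icc.1 hi).1; omega)]]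
              exact Finset.sum_le_sum_of_subset_of_nonneg (fun i hi => Finset.mem_Icc.2
                ⟨by have := (Finset.mem_Icc.1 hi).1; omega, by have := (Finset.mem_Icc.1 hi).2; omega⟩)
                (fun j hj _ => (hpos j hj).le)
            rw [hg0re]
            nlinarith)
        refine hS.congr fun μ => ?_
        rw [mul_zero, neg_zero, Real.rpow_zero, mul_one]
      · -- the inductive hypothesis at the complex parameters `(t; t₀ − iy, h₃, …, h_{n+3})`
        intro y g hg0' hg1' hgi'
        have hg0re' : (g 0).re = t := by rw [hg0', hg0re]
        have hg1re' : (g 1).re = t₀ := by rw [hg1']; simp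
        have hgi'' : ∀ i, 2 ≤ i → g i = h (i + 1) := fun i hi => by rw [hgi' i hi, hgi (i + 1) (by omega)]
        have hs2 : ∑ j ∈ Finset.Icc 2 (n + 2), (g j).re ≤ B := by
          have himg : Finset.image (fun j => j + 1) (Finset.Icc 2 (n + 2)) = Finset.Icc 3 (n + 3) := by
            ext i
            simp only [Finset.mem_image, Finset.mem_Icc]
            constructor
            · rintro ⟨j, hj, rfl⟩; omega
            · intro hi; exact ⟨i - 1, by omega, by omega⟩
          have hre : ∑ j ∈ Finset.Icc 2 (n + 2), (g j).re = ∑ i ∈ Finset.Icc 3 (n + 3), (h i).re := by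
            rw [← himg, Finset.sum_image fun a _ b _ hab => by simpa using hab]
            exact Finset.sum_congr rfl fun j hj => by rw [hgi'' j (Finset.mem_Icc.1 hj).1]
          rw [hre]
          exact Finset.sum_le_sum_of_subset_of_nonneg (fun i hi => Finset.mem_Icc.2
            ⟨by have := (Finset.mem_Icc.1 hi).1; omega, by have := (Finset.mem_Icc.1 hi).2; omega⟩)
            (fun j hj _ => (hpos j hj).le)
        refine IH g ?_ ?_ (by rw [hg0re']; exact ht0) (by rw [hg1re']; exact ht₀)
          (by rw [hgi'' (n + 2) (by omega)]; exact hn2) ?_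
        · have hI : Finset.Icc 1 (n + 2) = insert 1 (Finset.Icc 2 (n + 2)) := by
            ext i; simp only [Finset.mem_insert, Finset.mem_Icc]; omega
          rw [hI, Finset.sum_insert (by simp), hg1re', hg0re']
          have hq : 2 / ((n : ℝ) + 1) ≤ 1 := by rw [div_le_one (by positivity)]; linarith
          have hq0 : 0 ≤ 2 / ((n : ℝ) + 1) := by positivity
          nlinarith
        · intro j hj
          have hj' := Finset.mem_Icc.1 hj
          rw [hgi'' j hj'.1, hgi'' (j + 1) (by omega), hg0re']
          exact ⟨(h6 (j + 1) (Finset.mem_Icc.2 ⟨by omega, by omega⟩)).1,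
            by linarith [hle2 (j + 1) (j + 1 + 1) (by omega) (by omega) (by omega)]⟩
        · rw [hg1re', hgi'' 2 le_rfl, hg0re']
          linarith [hle1 3 (Finset.mem_Icc.2 ⟨by omega, by omega⟩)]
    -- continuation in `h₀` down to `v = h₀`
    have key := continuation (n := n + 1) (by omega) h hpos hM0 hM12 hM6 hM5 hML hreal hv
    rw [Function.update_eq_self] at key
    exact key

end Summit.KontsevichZagierPeriods.Zeta5Search.VWPInduction

end
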